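import Summits.BirchSwinnertonDyer.BirchSwinnertonDyer.Theorems.QuadraticBranchSignedControlPlusEtaNonsurjConjADoorEigen
import Summits.BirchSwinnertonDyer.BirchSwinnertonDyer.Theorems.QuadraticBranchSignedControlPlusEtaNonsurjConjADoorHeckeFixedLine
import Summits.BirchSwinnertonDyer.BirchSwinnertonDyer.Theorems.EisensteinPrimesAnalyticLambdaAbsoluteCount
import HarnessLib

/-!
# Route `QuadraticBranchSignedControl` (rung K8, cell `bsd-potss`), residual crux `PlusEtaMainConjectureNonsurj`
# (stmt-BirchSwinnertonDyer-19606): THE UNIT-ROW DOOR — Kobayashi's even main conjecture at `η` on a NON-onto row whose branch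
# function `L_p⁺(V,η,T)` is a UNIT of `Λ`, from statement (A) of the additive partner ALONE (seat `bsd-potss-k8eta-c2` g22)

WHY. On a row `V` of crux 19606 (`p ≥ 5` good supersingular, `a_p(V) = 0`, `p`-adic tower NOT onto) with additive partner `W`
(`C • W^{(p*)} = V`), Kobayashi's Thm. 4.1 gives only `pⁿ·L_p⁺(V,η,T) ∈ Char X⁺(V/K_∞)^η`; the cell's FINE ROAD (k8eta-c2 g6,
`EtaFineRoad.etaUpperIntegral_of_conjA_of_analyticMu`) removes the `pⁿ` — the INTEGRAL inclusion `(Lη) ⊆ Char` — from statement (A) of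
Coates–Sujatha for `(W,p)` and the analytic `μ(Lη) = 0`, and the class-group DOORS of g20/g21 (L6 `p ∤ h(ℚ(P))`, L6⁻ relative class
number, L2 eigen-test, L4 Hecke-refined eigen-test — all fact-free) supply (A)(W,p) from GRH class-group data of the degree-`p²−1` field
`ℚ(P)`. The reverse inclusion needs a lower bound: on the prime-`L` rank-one shape it is a point of infinite order (p691623/p703312/…), on
the rank-zero shape the lower half `L₀(W,p)` of `BSD(W,p)` (`MissingLowerBoundAt`, not instantiated on any non-CM row) or bsd.S28 (CM).
THIS FILE: when `L_p⁺(V,η,T)` is a UNIT of `Λ = ℤ_p⟦T⟧` (`μ = λ = 0`; by Kobayashi (3.6) and the cell's value identity this is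
`v_p(L(W,1)/Ω_W) = 0`), NO lower bound is needed at all: `(Lη) = Λ ⊆ Char` forces `Char X⁺(V/K_∞)^η = Λ = (Lη)`, and Thm. 2.2 at `η`
gives finite generation and torsion. So **(C1⁺_η)(V) ⟸ `h22 h41 h6273` + (A)(W,p) + «every `L_p⁺(V,η,T)` is a unit»** — no `BSD(W,p)`, no
`Sel_{p^∞}(W/ℚ) = 0` (the input of k8eta-c2 g2's unit road `EtaUnitRows`, there granted Burungale–Flach on CM rows), no `L₀`, no
Poitou–Tate / GZK / Kitajima–Otsuki, no CM hypothesis; compare k8q-c2 g2's `quadraticBranchPlusEtaMainConjectureAt_of_facts_of_surjective_of_isUnit`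
(the ONTO twin, where Thm. 4.1 is already integral).

WHAT. §1 `quadraticBranchPlusEtaMainConjectureAt_of_conjA_of_isUnit` (curve-generic: `W` elliptic, (A)(W,p) displayed in the cell's
`∃ γ D` currency). §2 the four door compositions on the partner of a row (`V` globally minimal; (c1), (c3), irreducibility automatic by
p690512): `…_of_not_dvd_classNumber_of_isUnit` (L6), `…_of_relClassNumber_of_isUnit` (L6⁻), `…_of_eigenHom_of_isUnit` (L2),
`…_of_heckeEigenHom_of_isUnit` (L4, `hVH`-free form of p706394).

SCOPE (numbers, not adjectives; k8eta-c2 g21 census at `p = 5`, GRH class numbers): the 188 in-table partner rows are NON-unit by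
construction (`5 ∣ #Ш_an·Tam`); in the UNCONGRUENT family u5a (the domain of v7's hardest stub `stub_etaMC_nonCM_uncongruent`, 104 twists,
22 resolved by kit j326613) the members `D = 8, 13, 17, 61` are UNIT rows (`ε = +1`, PARI plus-`η` `(λ, μ) = (0, 0)`, `r_an = 0`) with door
L6⁻ PASS (`h(ℚ(P))/h(ℚ(x(P))) = 30/15, 120/15, 60/15, 480/15`) — g21 left them «non-CM rank-0 shape: needs `MissingLowerBoundAt`»; §2 makes
them (C1⁺_η)@5 BY NAME (records in the sequel file), modulo `h22 h41 h6273`, two GRH class numbers and the PARI unit certificate; 18 more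
unit-shape members of u5a await a class number (kit j330280, this seat).

HONEST FRAMING (cell `bsd-potss`; FULL-BSD rank ≤ 1 programme, HUMAN RULING D-0036/D-0074): TOOL THEOREMS ONLY — no definition, no named
fact minted, no `sorry`, axioms standard; CONDITIONAL on the displayed named facts (`h22` Kobayashi Thm. 2.2 at `η`, `h41` Thm. 4.1 at `η`,
`h6273` Thm. 6.2/6.3/7.3 i) — hypothesis position) and per-row inputs (the class-group datum, the unit certificate — numerics are evidence, not
facts). No stub of 19606 is proved by name; the crux stays OPEN; nothing is booked; (A) and `BSD(W,p)` are claimed for no pair.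
`--supports stmt-BirchSwinnertonDyer-19606`.

References: [Kobayashi2003] Thm. 2.2 (p. 5), (3.6) (p. 7), §4 Even main conjecture + Thm. 4.1 (p. 8), Thm. 6.2/6.3/7.3 i) (p. 13);
[CoatesSujatha2005] §3 statement (A), Thm. 3.4; [Kato2004Asterisque] Thm. 12.5, §17.13; [GreenbergVatsal2000] p. 2 (2);
[DeoRaySujatha2023] Thm. 3.8 (c1)–(c3); [Kurihara2002] Thm. 0.1 (the unit case on the trivial component; shape only).
-/

set_option autoImplicit false
set_option linter.dupNamespace false
noncomputable section

open scoped Classical nonZeroDivisors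

open NumberField IsDedekindDomain Field WeierstrassCurve
open CongruenceSubgroup Literature.NumberTheory.EllipticCurves Literature.NumberTheory.EllipticCurves.ModularForms
  Literature.NumberTheory.EllipticCurves.Rank1Residual Literature.NumberTheory.EllipticCurves.Rank1Residual.Typed
  Literature.NumberTheory.GaloisRepresentations Literature.NumberTheory.GaloisCohomology Literature.NumberTheory.NumberFields
  Literature.NumberTheory.EllipticCurves.GreenbergVatsal2000 ZpExtension
open Summit.BirchSwinnertonDyer.Rank1Residual Summit.BirchSwinnertonDyer.Rank1Residual.Additive
open Summit.BirchSwinnertonDyer.BirchSwinnertonDyer.Theorems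

namespace Summit.BirchSwinnertonDyer.BirchSwinnertonDyer.Theorems.EtaConjADoorUnit

variable (p : ℕ) [hp : Fact p.Prime]

/-! ## §1 The unit-row door, curve-generic -/

section Generic

variable (W : WeierstrassCurve ℚ) [W.IsElliptic]

/-- **(C1⁺_η) on a UNIT row from (A)(W,p) ALONE (granted `h22 h41 h6273`).** `W/ℚ` elliptic, `V` a globally minimal model of the twist
`W^{(p*)}` (`C • W^{(p*)} = V`); assume statement (A) of Coates–Sujatha for `(W,p)` over the cyclotomic `ℤ_p`-extension (cell currency
`∃ γ D, D.X` finitely generated over `ℤ_p`) and that every function with the interpolation property of `L_p⁺(V,η,T)` (for the newform of `V`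
and the period ratio of the parity of `η`) is a UNIT of `Λ`. Then Kobayashi's even main conjecture at `η` holds at `(V,p)`: for every `η`-frame
and every dual datum `D`, `D.X` is finitely generated torsion and `Char(D.X) = (Lη)`. Proof: `(Lη) ⊆ Char` is the fine road's INTEGRAL Kato
inclusion (`EtaFineRoad.etaUpperIntegral_of_conjA_of_analyticMu`; its analytic-`μ` input is automatic for a unit, tree
`EisensteinPrimesAnalyticLambdaAbsoluteCount.hasUnitContent_of_isUnit`), `Char ⊆ (Lη) = Λ` is `le_top`, finiteness/torsion is Thm. 2.2
at `η` (`quadraticBranchPlusEtaMainConjectureAt_of_thm22_of_upper_of_etaLowerInclusion`). No image hypothesis is used (the statement is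
meant for the NON-onto rows, where Thm. 4.1 alone gives only `pⁿ`). CONDITIONAL; nothing booked.
[cite: Kobayashi2003, Thm. 2.2 (p. 5), §4 Even main conjecture and Thm. 4.1 first display (p. 8), Thm. 7.3 i) (7.21) (p. 13)]
[cite: CoatesSujatha2005, §3 statement (A)] [cite: GreenbergVatsal2000, p. 2 (2)] -/
theorem quadraticBranchPlusEtaMainConjectureAt_of_conjA_of_isUnit
    (h22 : Kobayashi2003.thm22_etaSignedSelmerDual_finite_torsion)
    (h41 : Kobayashi2003.thm41_plusEtaCharIdeal_dvd)
    (h6273 : Kobayashi2003.thm62_63_73_etaColemanPoitouTate)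
    (V : WeierstrassCurve ℚ) [V.IsElliptic] [V.IsGloballyMinimal] (C : VariableChange ℚ)
    (hCV : C • W.quadraticTwist ((-1) ^ (p / 2) * p) = V)
    (hA : ∀ (κ : ZpExtension ℚ p), κ.IsCyclotomic →
      ∃ (γ : absoluteGaloisGroup ℚ) (D : W.FineSelmerDualData κ γ),
        Module.Finite ℤ_[p] (RestrictScalars ℤ_[p] (IwasawaAlgebra p) D.X))
    (hunit : ∀ {N : ℕ} [NeZero N] {f : CuspForm (Gamma0 N) 2}, IsNewformOf V f →
      ∀ (ϖ : ℚ), (if Even (p / 2) then (ϖ : ℝ) * V.realPeriodRat = plusPeriod f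
          else (ϖ : ℝ) * V.imaginaryPeriodRat = minusPeriod f) →
      ∀ (Lη : IwasawaAlgebra p), IsQuadraticBranchPlusLFunction f p ϖ Lη → IsUnit Lη) :
    QuadraticBranchPlusEtaMainConjectureAt V p := by
  refine quadraticBranchPlusEtaMainConjectureAt_of_thm22_of_upper_of_etaLowerInclusion h22
    (EtaFineRoad.etaUpperIntegral_of_conjA_of_analyticMu W p h22 h41 h6273 V C hCV hA
      (fun hf ϖ hϖ Lη hL => EisensteinPrimesAnalyticLambdaAbsoluteCount.hasUnitContent_of_isUnit (hunit hf ϖ hϖ Lη hL))) ?_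
  -- (E⁺_η) is trivial on a unit row: `Char ⊆ (Lη) = Λ`
  intro K₀ _ _ _ _ ηq hηK hη1 N _ f hp2 hgood hap hf ϖ hϖ Lη hL κ γ hκ hγ hγK hγc D
  rw [Ideal.span_singleton_eq_top.mpr (hunit hf ϖ hϖ Lη hL)]
  exact le_top

end Generic

/-! ## §2 On the partner of a row of crux 19606: the unit-row door through the four class-group doors -/

section K8

variable (V : WeierstrassCurve ℚ) [V.IsElliptic] [V.IsGloballyMinimal] (W : WeierstrassCurve ℚ) [W.IsElliptic]
  (C : VariableChange ℚ)

/-- **Unit row ∘ door L6: (C1⁺_η)(V) from ONE class number** — `V` a row of crux 19606 (`p ≥ 5` good, `a_p = 0`, tower not onto) with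
partner `W` (`C • W^{(p*)} = V`), some `P ∈ W[p] ∖ 0` with `p ∤ h(ℚ(P))` (g20's fact-free door
`EtaConjADoor.conjA_partner_of_not_dvd_classNumber_stabilizerField`),
and every `L_p⁺(V,η,T)` a unit. Named facts `h22 h41 h6273`; displayed: the class number, the unit certificate. CONDITIONAL; nothing booked.
[cite: Kobayashi2003, §4 Even main conjecture and Thm. 4.1 (p. 8), Thm. 2.2 (p. 5)] [cite: CoatesSujatha2005, §3 (A) and Thm. 3.4]
[cite: DeoRaySujatha2023, §3 Thm. 3.8 (c1)–(c3) (arXiv:2202.09937 p. 9)] -/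
theorem quadraticBranchPlusEtaMainConjectureAt_of_not_dvd_classNumber_of_isUnit
    (h22 : Kobayashi2003.thm22_etaSignedSelmerDual_finite_torsion)
    (h41 : Kobayashi2003.thm41_plusEtaCharIdeal_dvd)
    (h6273 : Kobayashi2003.thm62_63_73_etaColemanPoitouTate)
    [NeZero p] (hp5 : 5 ≤ p) (hC : C • W.quadraticTwist ((-1) ^ (p / 2) * p) = V)
    (hgood : V.HasGoodReductionAtPrime p) (hap : V.frobeniusTrace p = 0)
    (hns : ¬ ∀ m : ℕ, V.HasSurjectiveModNGaloisRep (p ^ m : ℕ))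
    (hP : haveI : NumberField (W.divisionField p) := NumberField.mk
      ∃ P : geomTorsion W (p : ℤ), P ≠ 0 ∧
        ¬ p ∣ NumberField.classNumber (IntermediateField.fixedField
          ((MulAction.stabilizer (absoluteGaloisGroup ℚ) P).map (absRestrictNormalHom (W.divisionField p)))))
    (hunit : ∀ {N : ℕ} [NeZero N] {f : CuspForm (Gamma0 N) 2}, IsNewformOf V f →
      ∀ (ϖ : ℚ), (if Even (p / 2) then (ϖ : ℝ) * V.realPeriodRat = plusPeriod f
          else (ϖ : ℝ) * V.imaginaryPeriodRat = minusPeriod f) →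
      ∀ (Lη : IwasawaAlgebra p), IsQuadraticBranchPlusLFunction f p ϖ Lη → IsUnit Lη) :
    QuadraticBranchPlusEtaMainConjectureAt V p :=
  quadraticBranchPlusEtaMainConjectureAt_of_conjA_of_isUnit p W h22 h41 h6273 V C hC
    (EtaConjADoor.conjA_partner_of_not_dvd_classNumber_stabilizerField V p W C hp5 hC hgood hap hns hP) hunit

/-- **Unit row ∘ door L6⁻: (C1⁺_η)(V) from the RELATIVE class-number datum** `v_p h(ℚ(P)) ≤ v_p h(ℚ(P)^σ)` (`σ = τ|_{ℚ(P)}`, `τ • P = −P`;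
`ℚ(P)^σ = ℚ(x(P))`; g21's fact-free door `EtaConjADoorMinus.conjA_partner_of_relClassNumber`) and the unit certificate — the shape of the
UNCONGRUENT unit rows u5a:8, 13, 17, 61 at `p = 5` (`h/hx = 30/15, 120/15, 60/15, 480/15`). Named facts `h22 h41 h6273`. CONDITIONAL; nothing booked.
[cite: Kobayashi2003, §4 Even main conjecture and Thm. 4.1 (p. 8), Thm. 2.2 (p. 5)] [cite: CoatesSujatha2005, §3 (A) and Thm. 3.4]
[cite: NeukirchANT1999, Ch. III §1 Prop. (1.6) (ii),(iv)] -/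
theorem quadraticBranchPlusEtaMainConjectureAt_of_relClassNumber_of_isUnit
    (h22 : Kobayashi2003.thm22_etaSignedSelmerDual_finite_torsion)
    (h41 : Kobayashi2003.thm41_plusEtaCharIdeal_dvd)
    (h6273 : Kobayashi2003.thm62_63_73_etaColemanPoitouTate)
    [NeZero p] (hp5 : 5 ≤ p) (hC : C • W.quadraticTwist ((-1) ^ (p / 2) * p) = V)
    (hgood : V.HasGoodReductionAtPrime p) (hap : V.frobeniusTrace p = 0)
    (hns : ¬ ∀ m : ℕ, V.HasSurjectiveModNGaloisRep (p ^ m : ℕ))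
    (hP : haveI : NumberField (W.divisionField p) := NumberField.mk
      ∃ P : geomTorsion W (p : ℤ), P ≠ 0 ∧ ∀ τ : absoluteGaloisGroup ℚ, τ • P = -P →
        ∀ K : IntermediateField ℚ (W.divisionField p),
          K = IntermediateField.fixedField
            ((MulAction.stabilizer (absoluteGaloisGroup ℚ) P).map (absRestrictNormalHom (W.divisionField p))) →
        ∀ σ : K ≃ₐ[ℚ] K,
          (∀ x : K, absRestrictNormalHom (W.divisionField p) τ (x : W.divisionField p) =
            ((σ x : K) : W.divisionField p)) →
          padicValNat p (NumberField.classNumber K) ≤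
            padicValNat p (NumberField.classNumber (IntermediateField.fixedField (Subgroup.zpowers σ))))
    (hunit : ∀ {N : ℕ} [NeZero N] {f : CuspForm (Gamma0 N) 2}, IsNewformOf V f →
      ∀ (ϖ : ℚ), (if Even (p / 2) then (ϖ : ℝ) * V.realPeriodRat = plusPeriod f
          else (ϖ : ℝ) * V.imaginaryPeriodRat = minusPeriod f) →
      ∀ (Lη : IwasawaAlgebra p), IsQuadraticBranchPlusLFunction f p ϖ Lη → IsUnit Lη) :
    QuadraticBranchPlusEtaMainConjectureAt V p :=
  quadraticBranchPlusEtaMainConjectureAt_of_conjA_of_isUnit p W h22 h41 h6273 V C hC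
    (EtaConjADoorMinus.conjA_partner_of_relClassNumber p V W C hp5 hC hgood hap hns hP) hunit

/-- **Unit row ∘ door L2: (C1⁺_η)(V) from the plain tautological eigen-test** on `Cl(ℚ(P)) ⊗ 𝔽_p` («`2` is not an eigenvalue of `σ₂`»;
conjA g17's fact-free door through g21's wrapper `EtaConjADoorEigen.conjA_partner_of_eigenHom`) and the unit certificate. Named facts
`h22 h41 h6273`. CONDITIONAL; nothing booked. [cite: Kobayashi2003, §4 Even main conjecture and Thm. 4.1 (p. 8), Thm. 2.2 (p. 5)]
[cite: CoatesSujatha2005, §3 (A) and Thm. 3.4] [cite: DeoRaySujatha2023, §3 Thm. 3.8 (c2) (arXiv:2202.09937 p. 9)] -/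
theorem quadraticBranchPlusEtaMainConjectureAt_of_eigenHom_of_isUnit
    (h22 : Kobayashi2003.thm22_etaSignedSelmerDual_finite_torsion)
    (h41 : Kobayashi2003.thm41_plusEtaCharIdeal_dvd)
    (h6273 : Kobayashi2003.thm62_63_73_etaColemanPoitouTate)
    [NeZero p] (hp5 : 5 ≤ p) (hC : C • W.quadraticTwist ((-1) ^ (p / 2) * p) = V)
    (hgood : V.HasGoodReductionAtPrime p) (hap : V.frobeniusTrace p = 0)
    (hns : ¬ ∀ m : ℕ, V.HasSurjectiveModNGaloisRep (p ^ m : ℕ))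
    (hP : haveI : NumberField (W.divisionField p) := NumberField.mk
      ∃ P : geomTorsion W (p : ℤ), P ≠ 0 ∧
        ∀ K : IntermediateField ℚ (W.divisionField p),
          K = IntermediateField.fixedField
            ((MulAction.stabilizer (absoluteGaloisGroup ℚ) P).map (absRestrictNormalHom (W.divisionField p))) →
        ∀ μ : Additive (ClassGroup (𝓞 K)) →+ ZMod p,
          (∀ (τ : absoluteGaloisGroup ℚ) (σ : K ≃ₐ[ℚ] K) (a : ℕ),
              (∀ x : K, absRestrictNormalHom (W.divisionField p) τ (x : W.divisionField p) =
                ((σ x : K) : W.divisionField p)) → τ • P = a • P →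
              ∀ (I J : (Ideal (𝓞 K))⁰),
                (J : Ideal (𝓞 K)) = (I : Ideal (𝓞 K)).map (AmbiguousClass.intAut σ : 𝓞 K →+* 𝓞 K) →
                μ (Additive.ofMul (ClassGroup.mk0 J)) = a • μ (Additive.ofMul (ClassGroup.mk0 I))) →
          μ = 0)
    (hunit : ∀ {N : ℕ} [NeZero N] {f : CuspForm (Gamma0 N) 2}, IsNewformOf V f →
      ∀ (ϖ : ℚ), (if Even (p / 2) then (ϖ : ℝ) * V.realPeriodRat = plusPeriod f
          else (ϖ : ℝ) * V.imaginaryPeriodRat = minusPeriod f) →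
      ∀ (Lη : IwasawaAlgebra p), IsQuadraticBranchPlusLFunction f p ϖ Lη → IsUnit Lη) :
    QuadraticBranchPlusEtaMainConjectureAt V p :=
  quadraticBranchPlusEtaMainConjectureAt_of_conjA_of_isUnit p W h22 h41 h6273 V C hC
    (EtaConjADoorEigen.conjA_partner_of_eigenHom p V W C hp5 hC hgood hap hns hP) hunit

/-- **Unit row ∘ door L4: (C1⁺_η)(V) from the Hecke-refined eigen datum ALONE** (kit verdict TWIST / `T = 0`; g21's fact-free, `hVH`-free
door `EtaConjADoorHecke.conjA_partner_of_heckeEigenHom_auto`, p706394) and the unit certificate. Named facts `h22 h41 h6273`. CONDITIONAL;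
nothing booked. [cite: Kobayashi2003, §4 Even main conjecture and Thm. 4.1 (p. 8), Thm. 2.2 (p. 5)] [cite: CoatesSujatha2005, §3 (A) and Thm. 3.4]
[cite: DeoRaySujatha2023, §3 Thm. 3.8 (c2) and the definition of H′_L (arXiv:2202.09937 p. 9)] -/
theorem quadraticBranchPlusEtaMainConjectureAt_of_heckeEigenHom_of_isUnit
    (h22 : Kobayashi2003.thm22_etaSignedSelmerDual_finite_torsion)
    (h41 : Kobayashi2003.thm41_plusEtaCharIdeal_dvd)
    (h6273 : Kobayashi2003.thm62_63_73_etaColemanPoitouTate)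
    [NeZero p] (hp5 : 5 ≤ p) (hC : C • W.quadraticTwist ((-1) ^ (p / 2) * p) = V)
    (hgood : V.HasGoodReductionAtPrime p) (hap : V.frobeniusTrace p = 0)
    (hns : ¬ ∀ m : ℕ, V.HasSurjectiveModNGaloisRep (p ^ m : ℕ))
    (hP : haveI : NumberField (W.divisionField p) := NumberField.mk
      ∃ P : geomTorsion W (p : ℤ), P ≠ 0 ∧
        ∀ K : IntermediateField ℚ (W.divisionField p),
          K = IntermediateField.fixedField
            ((MulAction.stabilizer (absoluteGaloisGroup ℚ) P).map (absRestrictNormalHom (W.divisionField p))) →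
        ∀ μ : Additive (ClassGroup (𝓞 K)) →+ ZMod p,
          (∀ (τ : absoluteGaloisGroup ℚ) (σ : K ≃ₐ[ℚ] K) (a : ℕ),
              (∀ x : K, absRestrictNormalHom (W.divisionField p) τ (x : W.divisionField p) =
                ((σ x : K) : W.divisionField p)) → τ • P = a • P →
              ∀ (I J : (Ideal (𝓞 K))⁰),
                (J : Ideal (𝓞 K)) = (I : Ideal (𝓞 K)).map (AmbiguousClass.intAut σ : 𝓞 K →+* 𝓞 K) →
                μ (Additive.ofMul (ClassGroup.mk0 J)) = a • μ (Additive.ofMul (ClassGroup.mk0 I))) →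
          (∀ (τ τ₁ : absoluteGaloisGroup ℚ) (a a₁ b : ℕ) (Q : geomTorsion W (p : ℤ)),
              τ • P = a • P + Q → τ₁ • P = a₁ • P → τ₁ • Q = b • Q → (a₁ : ZMod p) ≠ (b : ZMod p) →
              ∀ I : (Ideal (𝓞 K))⁰,
                μ (Additive.ofMul (classGroupNorm K (W.divisionField p) (ClassGroup.mulEquiv
                  (AmbiguousClass.intAut (absRestrictNormalHom (W.divisionField p) τ))
                    (classGroupExtend K (W.divisionField p) (ClassGroup.mk0 I))))) =
                  (Nat.card ((W.divisionField p) ≃ₐ[K] (W.divisionField p)) * a) •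
                    μ (Additive.ofMul (ClassGroup.mk0 I))) →
          μ = 0)
    (hunit : ∀ {N : ℕ} [NeZero N] {f : CuspForm (Gamma0 N) 2}, IsNewformOf V f →
      ∀ (ϖ : ℚ), (if Even (p / 2) then (ϖ : ℝ) * V.realPeriodRat = plusPeriod f
          else (ϖ : ℝ) * V.imaginaryPeriodRat = minusPeriod f) →
      ∀ (Lη : IwasawaAlgebra p), IsQuadraticBranchPlusLFunction f p ϖ Lη → IsUnit Lη) :
    QuadraticBranchPlusEtaMainConjectureAt V p :=
  quadraticBranchPlusEtaMainConjectureAt_of_conjA_of_isUnit p W h22 h41 h6273 V C hC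
    (EtaConjADoorHecke.conjA_partner_of_heckeEigenHom_auto p V W C hp5 hC hgood hap hns hP) hunit

end K8

end Summit.BirchSwinnertonDyer.BirchSwinnertonDyer.Theorems.EtaConjADoorUnit

end
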